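import Summits.PneNP.PneNP.Theses.KarlinRubin
import Summits.PneNP.PneNP.Theorems.KarlinRubinMonotoneBlindCoverCompleteness
import Summits.PneNP.PneNP.Theorems.KarlinRubinMonotoneBlindStubResampling
import Summits.PneNP.PneNP.Theorems.KarlinRubinMonotoneBlindStubHingeGates
import Summits.PneNP.PneNP.Theorems.KarlinRubinMonotoneBlindStubHingeDnf
import Summits.PneNP.PneNP.Theorems.KarlinRubinMonotoneBlindStubWeakBlindDnf
import Summits.PneNP.PneNP.Theorems.KarlinRubinMonotoneBlindStubBlindAndDnf
import Summits.PneNP.PneNP.Theorems.KarlinRubinMonotoneBlindStubAdvIdentity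
import Summits.PneNP.PneNP.Theorems.KarlinRubinMonotoneBlindStubFairShare
import Summits.PneNP.PneNP.Theorems.KarlinRubinMonotoneBlindStubThresholdWeakBlind
import Summits.PneNP.PneNP.Theorems.KarlinRubinMonotoneBlindStubWeakBlindCnf
import Summits.PneNP.PneNP.Theorems.KarlinRubinMonotoneBlindStubOrDisjoint
import Summits.PneNP.PneNP.Theorems.KarlinRubinMonotoneBlindStubStageIdentity
import Summits.PneNP.PneNP.Theorems.KarlinRubinMonotoneBlindStubSmallCliqueInvisible
import Summits.PneNP.PneNP.Theorems.KarlinRubinMonotoneBlindStubOrDisjointFamily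
import Summits.PneNP.PneNP.Theorems.KarlinRubinMonotoneBlindFormOrCnf

/-!
# Crux `MonotoneBlind` (stmt-PneNP-18027, route KarlinRubin) — line `Sketch`, reshaped (lead c1): witness / hinge form

The crux: for every `δ ∈ (0,1/2)` and every `c`, NO family of `{∧₂, ∨₂, 0, 1}`-circuits on the edges of
`Kₙ` of size `≤ n^c` (eventually) has
`Pr_{G(n,1/2)}[C n = 1] + Pr_{G(n,1/2) ∪ K_A, |A| = ⌈n^{1/2-δ}⌉}[C n = 0] → 0`.

THE LINE (`Cruxes/MonotoneBlind/Ideas/vertex-cover-duality.md`; first skeleton `Lines/Sketch.lean` by lead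
prover-line-stmt-PneNP-18027-0). Cycle 1 of the line landed its three routine stubs (p158271, p158273, p158382)
and PROVED its hard stub `stub_coverCertificate` EQUIVALENT to STRONG BLINDNESS — every quiet polynomial-size
monotone family has planted acceptance `→ 0` at every exponent — (`stub_coverCertificate_iff_strongBlind`,
`monotoneBlind_of_strongBlind`, p160653). This reshape (continuation lead prover-line-stmt-PneNP-18027-c1-0)
keeps the composition `MonotoneBlind ⟸ StrongBlind` (landed) and reads the certificate ONE LEVEL DOWN, in the
language in which every class theorem landed so far (DNF p155629, CNF p157656, local-OR p158010, OR-of-CNFs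
p162264) is actually proved — the WITNESS / RESAMPLING method:

* Fibre over the planted input `y = plant A x` and RESAMPLE the `C(k,2)` slots inside `A`:
  `mix A x x' := (x outside A, x' inside A)`. The FIBRE DENSITY `dens_f(x,A) := Pr_{x'}[f (mix A x x') = 1]`
  has noise-average EXACTLY the null acceptance (`mix A x x'` is uniform), so by Markov
  `Pr_planted[f = 1] ≤ HingeMass_η(f) + η⁻¹ · Pr_null[f = 1]` for every `η` (`stub_resampling`, no
  monotonicity needed), where the HINGE MASS `HingeMass_η(f) := Pr_{A,x}[f(plant A x) = 1 ∧ dens_f(x,A) ≤ η]`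
  is the mass of planted inputs whose acceptance HINGES on the inside of the hidden `k`-set.
* Hence STRONG BLINDNESS ⟸ `stub_noDeepHinge`: for a quiet `≤ n^c` monotone family there is a level `η > 0`
  at which the hinge mass vanishes (THE hard stub; conversely it is implied by strong blindness since
  `HingeMass_η ≤ Pr_planted[f = 1]`, so it is again EXACTLY crux-strength — no line can do better, census
  D1–D5 — but it LOCALISES the event: hinge sets are subadditive over `∨`-gates (a witness child is hinged at
  the same level) and over `∧`-gates at level `√η` (Harris), `stub_hingeGates`; for a term `K_T` the hinge
  mass at level `2^{-t}` is the probability that `≥ t` slots of `T` fall inside `A` with the rest present —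
  the "heavy witness" quantity of the DNF theorem; the census counter-model `f⋆ = (Thr ∧ CLIQUE_k) ∨ Thr'`
  is deeply hinged through `CLIQUE_k` only (B2-correct), degree thresholds have hinge mass `≈ null × n^{-δ}`
  at every level (B3: rare because QUIET, not because light), so the invariant a proof must carry is
  "deep-hinge mass `≤ o(1)·null + size · n^{-Ω(depth)}`" per gate, and the open problem is ACCUMULATION under
  gate reuse (an `∨` of `n^c` individually shallow sub-circuits sharing gates).

Registered stubs (library vocabulary only; `k`-set law written as the normalised sum over `kSubsets`):

* `stub_resampling` (M, provable now) — `Pr_planted[f=1] ≤ HingeMass_η(f) + η⁻¹·Pr_null[f=1]`, all `n k f η`.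
* `stub_noDeepHinge` (THE HARD STUB, crux-strength) — quiet `≤ n^c` monotone families have vanishing hinge
  mass at some level `η > 0`.
* RUNGS of the hard stub (true instances / tools; NOT used by `MonotoneBlind_of`, landed as `--supports`):
  `stub_hingeGates` (M: `∨` exact, `∧` Harris product rule for fibre densities of monotone tests),
  `stub_hingeDnf` (M: poly-term DNFs have vanishing hinge mass at level `2^{-C(2c+3,2)}`, NO quietness —
  the heavy-witness half of p155629), `stub_weakBlindDnf` (L, NEW: EVERY poly-term monotone DNF family has
  advantage `→ 0` — rate `n^{-1-2δ+o(1)}`, tight for a single edge — by counting MINIMAL missing vertex sets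
  at failure points: in expectation `O_c(log n)^v` of size `v`), `stub_blindAndDnf` (L–XL, NEW CLASS: quiet
  ANDs of `≤ n^c` poly-term DNFs — depth 3 with `∧` on top — are strongly blind).

Composition `MonotoneBlind_of` (sorry-free): `monotoneBlind_of_strongBlind (strongBlind_of_specs …)`.

References: B. Rossman, FOCS 2010 / SICOMP 43 (2014) [Rossman2010]; J. Park, H. T. Pham, JAMS 37 (2024)
[ParkPham2024]; T. E. Harris, Proc. Camb. Phil. Soc. 56 (1960) / D. Kleitman, J. Combin. Theory 1 (1966)
(Harris–Kleitman) [folklore]; M. Jerrum (1992), L. Kučera (1995) (the planted model) [Jerrum1992, Kucera1995];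
J. Błasiok, L. Meierhöfer, arXiv:2501.09545 [BlasiokMeierhofer2025].
-/

set_option linter.dupNamespace false -- `Summit.PneNP.PneNP.…` is the layout-mandated namespace

namespace Summit.PneNP.PneNP.Cruxes.MonotoneBlind.VertexCover

open Literature.Computability.Complexity Literature.Probability.RandomGraphs.PlantedClique Filter Finset
open scoped ENNReal Topology

open scoped Classical

/-! ### The interface -/

/-- Resampling inside `A`: the edge vector that agrees with `x'` on the slots inside `A` and with `x`
elsewhere. `mixIn A x (fun _ => true) = plant A x`; for `x, x'` independent uniform, `mixIn A x x'` is uniform. -/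
def mixIn {n : ℕ} (A : Finset (Fin n)) (x x' : EdgeVec n) : EdgeVec n :=
  fun e => if (∀ v ∈ (e : Sym2 (Fin n)), v ∈ A) then x' e else x e

/-- FIBRE DENSITY of a test `f` at noise `x` and planted set `A`: the probability that `f` still accepts
after the slots inside `A` are resampled uniformly. Its noise-average is the null acceptance of `f`. -/
noncomputable def fiberDensity {n : ℕ} (f : EdgeVec n → Bool) (A : Finset (Fin n)) (x : EdgeVec n) : ℝ≥0∞ :=
  (erdosRenyiHalf n).toOuterMeasure {x' | f (mixIn A x x') = true}

/-- HINGE MASS of `f` at level `η` against the planted `k`-clique: the probability, under the planted pair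
`(A, x)`, that `f` accepts `plant A x` while its fibre density at `(x, A)` is `≤ η` (acceptance hinges on
the inside of `A`). -/
noncomputable def hingeMass (n k : ℕ) (f : EdgeVec n → Bool) (η : ℝ≥0∞) : ℝ≥0∞ :=
  ((#(kSubsets n k) : ℕ) : ℝ≥0∞)⁻¹ *
    ∑ A ∈ kSubsets n k, (erdosRenyiHalf n).toOuterMeasure {x | f (plant A x) = true ∧ fiberDensity f A x ≤ η}

/-- `ResamplingSpec` (content of `stub_resampling`): planted acceptance `≤` hinge mass `+ η⁻¹ ·` null
acceptance, for every test and every level. -/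
def ResamplingSpec : Prop :=
  ∀ (n k : ℕ) (f : EdgeVec n → Bool) (η : ℝ≥0∞),
    (plantedCliqueDist n k).toOuterMeasure {y | f y = true} ≤
      hingeMass n k f η + η⁻¹ * (erdosRenyiHalf n).toOuterMeasure {x | f x = true}

/-- `NoDeepHingeSpec` (content of `stub_noDeepHinge`): quiet polynomial-size monotone families have
vanishing hinge mass at some positive level. -/
def NoDeepHingeSpec : Prop :=
  ∀ δ : ℝ, 0 < δ → δ < 1 / 2 → ∀ c : ℕ, ∀ C : (n : ℕ) → Circuit ((⊤ : SimpleGraph (Fin n)).edgeSet),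
    (∀ᶠ n : ℕ in atTop, (C n).IsOver monotoneBasis01 ∧ (C n).size ≤ n ^ c) →
    Tendsto (fun n : ℕ => (erdosRenyiHalf n).toOuterMeasure {x | (C n).eval x = true}) atTop (𝓝 0) →
    ∃ η : ℝ≥0∞, 0 < η ∧
      Tendsto (fun n : ℕ => hingeMass n ⌈(n : ℝ) ^ (1 / 2 - δ)⌉₊ (C n).eval η) atTop (𝓝 0)

/-! ### Registered stubs

Each stub is stated in LIBRARY VOCABULARY ONLY (the interface `def`s above are unfolded: `mixIn A x x'` is
the lambda `fun e => if (∀ v ∈ (e : Sym2 (Fin n)), v ∈ A) then x' e else x e`, under `open scoped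
Classical`), so that a stub-worker's Theorems file can state it verbatim; `…_of_stub` below folds them back
by `rfl`. -/

/-- **stub_resampling** (M; the general witness / resampling inequality — no monotonicity, no size).
For every `n k`, every test `f : EdgeVec n → Bool` and every level `η : ℝ≥0∞`:
`Pr_{G(n,1/2,k)}[f = 1] ≤ (#kSubsets)⁻¹ Σ_A Pr_x[f(plant A x) = 1 ∧ dens_f(x,A) ≤ η] + η⁻¹ · Pr_{G(n,1/2)}[f = 1]`,
`dens_f(x,A) = Pr_{x'}[f(x outside A, x' inside A) = 1]`. Proof: fibre the planted law over `A`
(`plantedCliqueDist_toOuterMeasure_eq_sum`); for fixed `A` split `{f ∘ plant A = 1}` by `dens ≤ η`; on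
`{dens > η}` use Markov, `Pr_x[dens_f(x,A) > η] ≤ η⁻¹ E_x[dens_f(x,A)]`, and the exact identity
`E_x[dens_f(x,A)] = Pr_x[f x = 1]` (the pair `(x, x') ↦ mixIn A x x'` pushes uniform × uniform to uniform).
Degenerate `η = 0` (`η⁻¹ = ⊤`): if `Pr_null[f=1] = 0` then `f ≡ false`. [folklore] -/
theorem stub_resampling :
    ∀ (n k : ℕ) (f : EdgeVec n → Bool) (η : ℝ≥0∞),
      (plantedCliqueDist n k).toOuterMeasure {y | f y = true} ≤
        ((#(kSubsets n k) : ℕ) : ℝ≥0∞)⁻¹ *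
            ∑ A ∈ kSubsets n k, (erdosRenyiHalf n).toOuterMeasure
              {x | f (plant A x) = true ∧
                (erdosRenyiHalf n).toOuterMeasure
                  {x' | f (fun e => if (∀ v ∈ (e : Sym2 (Fin n)), v ∈ A) then x' e else x e) = true} ≤ η} +
          η⁻¹ * (erdosRenyiHalf n).toOuterMeasure {x | f x = true} :=
  Summit.PneNP.PneNP.Theorems.MonotoneBlind.VertexCover.stub_resampling

/-- **stub_noDeepHinge** (THE HARD STUB — crux-strength, XL / open). For `δ ∈ (0,1/2)`, `c : ℕ` and a
family `C` of `{∧₂, ∨₂, 0, 1}`-circuits of size `≤ n^c` (eventually) with null acceptance `→ 0`, there is a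
level `η > 0` such that the HINGE MASS
`(#kSubsets)⁻¹ Σ_A Pr_x[(C n)(plant A x) = 1 ∧ Pr_{x'}[(C n)(x outside A, x' inside A) = 1] ≤ η] → 0`
(`k = ⌈n^{1/2-δ}⌉`). Why true iff the crux's strong form: `≤` planted acceptance (so implied by strong
blindness), and with `stub_resampling` it implies strong blindness. Why attackable: the hinge set of an `∨`
is the union of the children's hinge sets at the same level and of an `∧` the union at level `√η` (Harris;
`stub_hingeGates`); for terms / DNFs / CNFs the deep-hinge mass is `O(n^{-2})` unconditionally (heavy
witnesses, `stub_hingeDnf`, seat-0 rescue lemma); the honest residue is ACCUMULATION under gate reuse.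
Calibration: must fail for the `n^{3 log n}`-term clique DNF (it does: `A ⊇ T` has probability
`n^c (k/n)^{3 log n} ↛ 0` only when `c ≈ 3 log n`). [cite: Rossman2010, §9] [cite: BlasiokMeierhofer2025, Thm 1.3] -/
theorem stub_noDeepHinge :
    ∀ δ : ℝ, 0 < δ → δ < 1 / 2 → ∀ c : ℕ, ∀ C : (n : ℕ) → Circuit ((⊤ : SimpleGraph (Fin n)).edgeSet),
      (∀ᶠ n : ℕ in atTop, (C n).IsOver monotoneBasis01 ∧ (C n).size ≤ n ^ c) →
      Tendsto (fun n : ℕ => (erdosRenyiHalf n).toOuterMeasure {x | (C n).eval x = true}) atTop (𝓝 0) →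
      ∃ η : ℝ≥0∞, 0 < η ∧
        Tendsto (fun n : ℕ =>
          ((#(kSubsets n ⌈(n : ℝ) ^ (1 / 2 - δ)⌉₊) : ℕ) : ℝ≥0∞)⁻¹ *
            ∑ A ∈ kSubsets n ⌈(n : ℝ) ^ (1 / 2 - δ)⌉₊, (erdosRenyiHalf n).toOuterMeasure
              {x | (C n).eval (plant A x) = true ∧
                (erdosRenyiHalf n).toOuterMeasure
                  {x' | (C n).eval (fun e => if (∀ v ∈ (e : Sym2 (Fin n)), v ∈ A) then x' e else x e)
                    = true} ≤ η}) atTop (𝓝 0) := by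
  sorry

/-! ### Rungs of the hard stub (registered; true instances and tools, landed as `--supports`) -/

/-- **stub_hingeGates** (M; the gate calculus of hinge sets). For tests `g h : EdgeVec n → Bool`, a vertex
set `A` and a noise `x`, with `dens_f := Pr_{x'}[f(x outside A, x' inside A) = 1]`:
(∨) `dens_{g ∨ h} ≥ max (dens_g) (dens_h)` — stated as the two inequalities (monotonicity of measure);
(∧) for MONOTONE `g, h`: `dens_{g ∧ h} ≥ dens_g · dens_h` (Harris–Kleitman: two up-sets of the uniform
cube `EdgeVec n` are positively correlated; Mathlib `IsUpperSet.le_card_inter_finset` transported along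
`x' ↦ {e | x' e = true}`). Consequence (not part of the statement): the hinge set of `g ∨ h` at level `η`
lies in the union of the children's at level `η`, that of `g ∧ h` in the union at levels `η₁, η₂` with
`η₁ η₂ = η`. [folklore] -/
theorem stub_hingeGates :
    (∀ (n : ℕ) (A : Finset (Fin n)) (g h : EdgeVec n → Bool) (x : EdgeVec n),
      (erdosRenyiHalf n).toOuterMeasure
          {x' | g (fun e => if (∀ v ∈ (e : Sym2 (Fin n)), v ∈ A) then x' e else x e) = true} ≤
        (erdosRenyiHalf n).toOuterMeasure
          {x' | (g (fun e => if (∀ v ∈ (e : Sym2 (Fin n)), v ∈ A) then x' e else x e) ||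
            h (fun e => if (∀ v ∈ (e : Sym2 (Fin n)), v ∈ A) then x' e else x e)) = true}) ∧
    (∀ (n : ℕ) (A : Finset (Fin n)) (g h : EdgeVec n → Bool), Monotone g → Monotone h → ∀ x : EdgeVec n,
      (erdosRenyiHalf n).toOuterMeasure
          {x' | g (fun e => if (∀ v ∈ (e : Sym2 (Fin n)), v ∈ A) then x' e else x e) = true} *
        (erdosRenyiHalf n).toOuterMeasure
          {x' | h (fun e => if (∀ v ∈ (e : Sym2 (Fin n)), v ∈ A) then x' e else x e) = true} ≤
      (erdosRenyiHalf n).toOuterMeasure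
          {x' | (g (fun e => if (∀ v ∈ (e : Sym2 (Fin n)), v ∈ A) then x' e else x e) &&
            h (fun e => if (∀ v ∈ (e : Sym2 (Fin n)), v ∈ A) then x' e else x e)) = true}) :=
  Summit.PneNP.PneNP.Theorems.MonotoneBlind.VertexCover.stub_hingeGates

/-- **stub_hingeDnf** (M; hinge form of the DNF theorem, NO quietness). For `δ ∈ (0,1/2)`, `c`, and term
families `𝓔 n` with `#(𝓔 n) ≤ n^c` eventually, the monotone DNF `x ↦ [∃ E ∈ 𝓔 n, E ⊆ x]` has vanishing
hinge mass at the level `η = 2^{-C(2(c+2)-1, 2)}`: in a hinged pair `(A, x)` every witness term `E ⊆ plant A x`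
has `> t` slots inside `A` (a witness with `≤ t` inside slots gives density `≥ 2^{-t}`), and the mass of
planted inputs all of whose witnesses are `t`-heavy is `≤ 2/n²` eventually (`dnf_termBound_tail`,
`dnf_termBound_large`, `eventually_H1/H2/H3` of `KarlinRubinMonotoneBlindDnf{Planted,Bounds,Blind}`).
[folklore] -/
theorem stub_hingeDnf :
    ∀ δ : ℝ, 0 < δ → δ < 1 / 2 → ∀ c : ℕ,
      ∀ 𝓔 : (n : ℕ) → Finset (Finset ((⊤ : SimpleGraph (Fin n)).edgeSet)),
      (∀ᶠ n : ℕ in atTop, #(𝓔 n) ≤ n ^ c) →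
      ∃ η : ℝ≥0∞, 0 < η ∧
        Tendsto (fun n : ℕ =>
          ((#(kSubsets n ⌈(n : ℝ) ^ (1 / 2 - δ)⌉₊) : ℕ) : ℝ≥0∞)⁻¹ *
            ∑ A ∈ kSubsets n ⌈(n : ℝ) ^ (1 / 2 - δ)⌉₊, (erdosRenyiHalf n).toOuterMeasure
              {x | (∃ E ∈ 𝓔 n, ∀ e ∈ E, plant A x e = true) ∧
                (erdosRenyiHalf n).toOuterMeasure
                  {x' | ∃ E ∈ 𝓔 n, ∀ e ∈ E,
                    (if (∀ v ∈ (e : Sym2 (Fin n)), v ∈ A) then x' e else x e) = true} ≤ η}) atTop (𝓝 0) :=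
  Summit.PneNP.PneNP.Theorems.MonotoneBlind.VertexCover.stub_hingeDnf

/-- **stub_weakBlindDnf** (L; NEW — weak blindness of EVERY polynomial-term monotone DNF, no quietness).
For `δ ∈ (0,1/2)`, `c`, and term families with `#(𝓔 n) ≤ n^c` eventually:
`Pr_planted[∃ E ⊆ y] ≤ Pr_null[∃ E ⊆ x] + ε n` eventually, with `ε n → 0` (in fact `ε n = n^{-1-2δ+o(1)}`,
tight for a single edge). Proof (cover at EVERY failure point): for `x` with no term present,
`Pr_A[∃ E, E ∖ x ⊆ E(A)] ≤ Σ_{S ∈ 𝒮(x)} (d/n)^{|S|}` over the MINIMAL vertex sets `S` among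
`{V(E ∖ x)}` (fibre factor `card_kSubsets_filter_superset_mul_le`); sizes `|S| > 2c+2` cost `≤ n^c (d/n)^{2c+3}`
in total; for `2 ≤ v ≤ 2c+2` the pairs `(x, S)` inject (`x⁺ := x ∪ (E ∖ x)`) into pairs `(x⁺, M)` with
`M ⊆ x⁺`, `|V(M)| = v`, no term inside `x⁺ ∖ M`, and — by minimality — `V(M) ⊆ V(E')` for EVERY term
`E' ⊆ x⁺`; so their number at `x⁺` is `≤ 2^{C(v,2)} · (2 w(x⁺))^v`, `w(x⁺)` = least size of a present term,
and `E_x[1[some term of size ≤ w present] (2w)^v] ≤ (2w₁)^v + Σ_{|E| > w₁} 2^{-|E|} (2|E|)^v = O_c(log n)^v`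
with `w₁ = (c+1) log₂ n`. [folklore] -/
theorem stub_weakBlindDnf :
    ∀ δ : ℝ, 0 < δ → δ < 1 / 2 → ∀ c : ℕ,
      ∀ 𝓔 : (n : ℕ) → Finset (Finset ((⊤ : SimpleGraph (Fin n)).edgeSet)),
      (∀ᶠ n : ℕ in atTop, #(𝓔 n) ≤ n ^ c) →
      ∃ ε : ℕ → ℝ≥0∞, Tendsto ε atTop (𝓝 0) ∧
        ∀ᶠ n : ℕ in atTop,
          (plantedCliqueDist n ⌈(n : ℝ) ^ (1 / 2 - δ)⌉₊).toOuterMeasure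
              {x | ∃ E ∈ 𝓔 n, ∀ e ∈ E, x e = true} ≤
            (erdosRenyiHalf n).toOuterMeasure {x | ∃ E ∈ 𝓔 n, ∀ e ∈ E, x e = true} + ε n :=
  Summit.PneNP.PneNP.Theorems.MonotoneBlind.VertexCover.stub_weakBlindDnf

/-- **stub_blindAndDnf** (L–XL; NEW CLASS — depth 3 with `∧` on top). For `δ ∈ (0,1/2)`, `c`, `m n ≤ n^c`
DNFs `𝓓 n i` with `≤ n^c` terms each (eventually): if the monotone test `x ↦ [∀ i, ∃ E ∈ 𝓓 n i, E ⊆ x]`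
is QUIET (`Pr_{G(n,1/2)} → 0`) then its planted acceptance `→ 0`. Suggested route: resampling
(`stub_resampling`) + Harris (`stub_hingeGates`: `dens_∧ ≥ ∏ dens_{D_i} ≥ 2^{-Σ t_i}`, `t_i` = least number
of inside-`A` slots of a witness term of `D_i`), then split: ONE `D_i` with a `T₁`-heavy witness
(`stub_hingeDnf`-type bound, `o(n^{-c})` per DNF for `T₁ = T₁(c,δ)`), or MANY block-pivotal `D_i`
(`D_i(y) = 1`, `D_i(x with inside-A slots off) = 0`) — the part that needs an idea (Janson / minimal
missing sets as in `stub_weakBlindDnf`, jointly over `i`). A counterexample would be as informative.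
[folklore] -/
theorem stub_blindAndDnf :
    ∀ δ : ℝ, 0 < δ → δ < 1 / 2 → ∀ c : ℕ, ∀ m : ℕ → ℕ,
      ∀ 𝓓 : (n : ℕ) → Fin (m n) → Finset (Finset ((⊤ : SimpleGraph (Fin n)).edgeSet)),
      (∀ᶠ n : ℕ in atTop, m n ≤ n ^ c) →
      (∀ᶠ n : ℕ in atTop, ∀ i, #(𝓓 n i) ≤ n ^ c) →
      Tendsto (fun n : ℕ => (erdosRenyiHalf n).toOuterMeasure
        {x | ∀ i, ∃ E ∈ 𝓓 n i, ∀ e ∈ E, x e = true}) atTop (𝓝 0) →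
      Tendsto (fun n : ℕ => (plantedCliqueDist n ⌈(n : ℝ) ^ (1 / 2 - δ)⌉₊).toOuterMeasure
        {x | ∀ i, ∃ E ∈ 𝓓 n i, ∀ e ∈ E, x e = true}) atTop (𝓝 0) :=
  Summit.PneNP.PneNP.Theorems.MonotoneBlind.VertexCover.stub_blindAndDnf

/-! ### Rungs, wave 2 (registered 2026-08-17, lead c1): the dead–revival / minimal-completion framework

For a monotone test `f`, planted acceptance `=` null acceptance `+` ADVANTAGE, and the advantage is the mass
of DEAD noises REVIVED by the clique: `adv = (#kSubsets)⁻¹ Σ_A Pr_x[f x = 0 ∧ f (plant A x) = 1]`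
(`stub_advIdentity`). At a dead noise `x`, revival needs `A` to cover the vertex set of a MINIMAL COMPLETION
(a minterm of the restriction `M ↦ f (x ∪ M)` on the off slots) — an `x`-determined object of which `A` is
independent — so `Pr_A[revive] ≤ Σ_{U minimal} (d/n)^{|U|}` (the landed count
`card_filter_plant_exists_mul_pow_le` applied to the DNF of minterms of `f_x`). Weak blindness of a class thus
reduces to: at typical dead noises the minimal completions are FEW or WIDE. Calibrations registered here:
single-edge completions are negligible for EVERY monotone `f` (`stub_fairShare`, the unate total-influence bound —
the `|U| = 2` level is free, `≤ (d/n)² √N ≈ 0.7 n^{-2δ}`); edge-count thresholds are weakly blind although they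
have `N^{Θ(1)}` minimal completions near the threshold (`stub_thresholdWeakBlind`: rare closeness, not
lightness — barrier note B3 in the framework's own terms); poly-clause CNFs are weakly blind unconditionally
(`stub_weakBlindCnf`: a dead clause of width `≤ (c+1) log₂ n` must be hit inside `A`). -/

/-- **stub_advIdentity** (S–M; the dead–revival identity). For every `n k` and every MONOTONE test `f`
(pointwise order on `EdgeVec n`, `false < true`): planted acceptance `=` null acceptance `+`
`(#kSubsets)⁻¹ Σ_{A ∈ kSubsets} Pr_{G(n,1/2)}[f x = false ∧ f (plant A x) = true]`. Proof: for each `A`,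
`{x | f (plant A x) = true}` is the disjoint union of `{f x = true}` (as `x ≤ plant A x`, `le_plant`) and the
revival set; `plantedCliqueDist_toOuterMeasure_eq_sum`; average. [folklore] -/
theorem stub_advIdentity :
    ∀ (n k : ℕ) (f : EdgeVec n → Bool), Monotone f →
      (plantedCliqueDist n k).toOuterMeasure {y | f y = true} =
        (erdosRenyiHalf n).toOuterMeasure {x | f x = true} +
          ((#(kSubsets n k) : ℕ) : ℝ≥0∞)⁻¹ *
            ∑ A ∈ kSubsets n k, (erdosRenyiHalf n).toOuterMeasure {x | f x = false ∧ f (plant A x) = true} :=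
  Summit.PneNP.PneNP.Theorems.MonotoneBlind.VertexCover.stub_advIdentity

/-- **stub_fairShare** (M; single-edge revivals are negligible for EVERY monotone test — the `|U| = 2` level
of the minimal-completion cover, = ideator 1's fair-share benchmark at stage 0). For `n k` and monotone `f`:
`(#kSubsets)⁻¹ Σ_A Pr_x[f x = false ∧ ∃ e inside A, f (x with e on) = true] ≤ (d/n)² (⌊√N⌋ + 1)`,
`d = min k n`, `N = #E(Kₙ)`. Proof: swap sums; `Pr_A[e inside A] ≤ (d/n)²` (fibre factor
`card_kSubsets_filter_superset_mul_le` at the 2-set `V(e)`); `Σ_e Pr_x[f x = false ∧ f(x with e on) = true]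
≤ Σ_e Inf_e(f) ≤ √N` by the in-tree unate bound `Literature.Computability.Complexity.unate_sum_card_pivotal_le`.
With `d ≈ n^{1/2-δ}`, `N ≈ n²/2`: `≤ 0.71 n^{-2δ} → 0`. [folklore] -/
theorem stub_fairShare :
    ∀ (n k : ℕ) (f : EdgeVec n → Bool), Monotone f →
      ((#(kSubsets n k) : ℕ) : ℝ≥0∞)⁻¹ *
          ∑ A ∈ kSubsets n k, (erdosRenyiHalf n).toOuterMeasure
            {x | f x = false ∧ ∃ e : (⊤ : SimpleGraph (Fin n)).edgeSet,
              (∀ v ∈ (e : Sym2 (Fin n)), v ∈ A) ∧ f (Function.update x e true) = true} ≤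
        ((((min k n : ℕ) : ℝ≥0∞) / (n : ℝ≥0∞)) ^ 2) *
          ((Nat.sqrt (Fintype.card (⊤ : SimpleGraph (Fin n)).edgeSet) + 1 : ℕ) : ℝ≥0∞) :=
  Summit.PneNP.PneNP.Theorems.MonotoneBlind.VertexCover.stub_fairShare

/-- **stub_thresholdWeakBlind** (M–L; edge-count thresholds are weakly blind — calibration of barrier note B3).
For `δ ∈ (0,1/2)` and ANY thresholds `θ n`, the monotone test `[#{e | x e = true} ≥ θ n]` satisfies
`Pr_planted ≤ Pr_null + ε n` eventually with `ε n → 0`. Proof: planting switches on at most the `C(d,2)`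
slots inside `A`, so `Pr_planted[#on ≥ θ] ≤ Pr_null[#on ≥ θ - C(d,2)] ≤ Pr_null[#on ≥ θ] + C(d,2) · max_j
Pr[Bin(N,1/2) = j]`, and `max_j C(N,j)/2^N ≤ 1/√(N+1)` (`Nat.choose_le_middle` + the Wallis bound
`Literature.Probability.LatticeModels.centralBinom_div_sq_mul_le : (C(2m,m)/4^m)² (2m+1) ≤ 1`, odd `N` via
`C(2m+1,m) = C(2m+2,m+1)/2`); `C(d,2)/√(N+1) ≤ d²/n·2 = O(n^{-2δ}) → 0`. [folklore] -/
theorem stub_thresholdWeakBlind :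
    ∀ δ : ℝ, 0 < δ → δ < 1 / 2 → ∀ θ : ℕ → ℕ,
      ∃ ε : ℕ → ℝ≥0∞, Tendsto ε atTop (𝓝 0) ∧
        ∀ᶠ n : ℕ in atTop,
          (plantedCliqueDist n ⌈(n : ℝ) ^ (1 / 2 - δ)⌉₊).toOuterMeasure
              {x | θ n ≤ #(univ.filter fun e : (⊤ : SimpleGraph (Fin n)).edgeSet => x e = true)} ≤
            (erdosRenyiHalf n).toOuterMeasure
              {x | θ n ≤ #(univ.filter fun e : (⊤ : SimpleGraph (Fin n)).edgeSet => x e = true)} + ε n :=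
  Summit.PneNP.PneNP.Theorems.MonotoneBlind.VertexCover.stub_thresholdWeakBlind

/-- **stub_weakBlindCnf** (M; weak blindness of EVERY polynomial-clause monotone CNF, no quietness — the
depth-2 dual of `stub_weakBlindDnf`). For `δ ∈ (0,1/2)`, `c`, clause families `𝓒 n` with `#(𝓒 n) ≤ n^c`
eventually: `Pr_planted[∀ C ∈ 𝓒 n, some slot of C on] ≤ Pr_null[same] + ε n` eventually, `ε n → 0`. Proof:
a dead noise has a DEAD clause `C` (all slots off); revival needs a slot of `C` inside `A`:
`Pr_A ≤ #C · (d/n)²`; clauses wider than `W = (c+1)(log₂ n + 1)` are dead with probability `≤ n^c 2^{-W}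
≤ n⁻¹` in total, so `adv ≤ W (d/n)² + n⁻¹ → 0`. [folklore] -/
theorem stub_weakBlindCnf :
    ∀ δ : ℝ, 0 < δ → δ < 1 / 2 → ∀ c : ℕ,
      ∀ 𝓒 : (n : ℕ) → Finset (Finset ((⊤ : SimpleGraph (Fin n)).edgeSet)),
      (∀ᶠ n : ℕ in atTop, #(𝓒 n) ≤ n ^ c) →
      ∃ ε : ℕ → ℝ≥0∞, Tendsto ε atTop (𝓝 0) ∧
        ∀ᶠ n : ℕ in atTop,
          (plantedCliqueDist n ⌈(n : ℝ) ^ (1 / 2 - δ)⌉₊).toOuterMeasure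
              {x | ∀ C ∈ 𝓒 n, ∃ e ∈ C, x e = true} ≤
            (erdosRenyiHalf n).toOuterMeasure {x | ∀ C ∈ 𝓒 n, ∃ e ∈ C, x e = true} + ε n :=
  Summit.PneNP.PneNP.Theorems.MonotoneBlind.VertexCover.stub_weakBlindCnf

/-- **stub_orDisjoint** (S–M; toy ACCUMULATION lemma — an `∨` of children with DISJOINT supports). For tests
`g, h` determined by disjoint slot sets `S, T` and any planted set `A`: the dead–revival mass of `g || h` at `A` is
`≤ adv_A(g) · Pr[h dead] + adv_A(h) · Pr[g dead]` (`adv_A(f) := Pr_x[f x = false ∧ f (plant A x) = true]`):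
revival of the `∨` revives a child while the other is dead, and events determined by disjoint coordinate sets are
independent under `G(n,1/2)` (`Literature.Probability.Moments.card_filter_and_mul_eq`). Moral (not part of the
statement): without overlap an `∨` of `m` children accumulates advantage only through children whose revival rate is
comparable to their ALIVE-probability (multiplicative advantage), which is what size must forbid. [folklore] -/
theorem stub_orDisjoint :
    ∀ (n : ℕ) (A : Finset (Fin n)) (S T : Finset ((⊤ : SimpleGraph (Fin n)).edgeSet)), Disjoint S T →
      ∀ g h : EdgeVec n → Bool,
      (∀ x x' : EdgeVec n, (∀ e ∈ S, x e = x' e) → g x = g x') →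
      (∀ x x' : EdgeVec n, (∀ e ∈ T, x e = x' e) → h x = h x') →
      (erdosRenyiHalf n).toOuterMeasure
          {x | (g x || h x) = false ∧ (g (plant A x) || h (plant A x)) = true} ≤
        (erdosRenyiHalf n).toOuterMeasure {x | g x = false ∧ g (plant A x) = true} *
            (erdosRenyiHalf n).toOuterMeasure {x | h x = false} +
          (erdosRenyiHalf n).toOuterMeasure {x | h x = false ∧ h (plant A x) = true} *
            (erdosRenyiHalf n).toOuterMeasure {x | g x = false} :=
  Summit.PneNP.PneNP.Theorems.MonotoneBlind.VertexCover.stub_orDisjoint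

/-! ### Rungs, wave 3 (registered 2026-08-17, lead c1): stage decomposition, free negatives, ∨-accumulation

See `Lines/Sketch.md` §C3–C4. -/

/-- **stub_stageIdentity** (M; the vertex-ignition / stage decomposition, one step). For monotone `f`, `j + 1 ≤ n`:
acceptance with a planted uniform `(j+1)`-clique `=` acceptance with a planted uniform `j`-clique `+` the STAGE-`j`
REVIVAL mass: average over `A ∈ kSubsets n j` and a uniform vertex `v ∉ A` of
`Pr_x[f(plant A x) = false ∧ f(plant (insert v A) x) = true]` (the star of `v` into `A` revives `f`). Proof: the
coupling "uniform `(j+1)`-set `=` uniform `j`-set `+` uniform outside vertex" (each `(j+1)`-set arises from exactly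
`j+1` pairs), `plantedCliqueDist_toOuterMeasure_eq_sum`, and the disjoint split by monotonicity
(`plant A x ≤ plant (insert v A) x`, `plant_mono_set`). Summing over `j < d` telescopes to `adv = Σ_j stage_j`.
[folklore] -/
theorem stub_stageIdentity :
    ∀ (n j : ℕ) (f : EdgeVec n → Bool), Monotone f → j + 1 ≤ n →
      (plantedCliqueDist n (j + 1)).toOuterMeasure {y | f y = true} =
        (plantedCliqueDist n j).toOuterMeasure {y | f y = true} +
          ((#(kSubsets n j) : ℕ) : ℝ≥0∞)⁻¹ * ∑ A ∈ kSubsets n j,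
            (((n - j : ℕ) : ℝ≥0∞))⁻¹ * ∑ v ∈ univ \ A,
              (erdosRenyiHalf n).toOuterMeasure
                {x | f (plant A x) = false ∧ f (plant (insert v A) x) = true} :=
  Summit.PneNP.PneNP.Theorems.MonotoneBlind.VertexCover.stub_stageIdentity

/-- **stub_smallCliqueInvisible** (M–L; the information-theoretic lower half of the `2 log₂ n` threshold — FREE
NEGATIVES for the vertex-set form of the hard stub). For every `ε > 0`, every clique-size sequence with
`b n ≤ (2 - ε) log₂ n` eventually and EVERY family of tests `f n` (no monotonicity, no size bound): the planted-`b n`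
acceptance and the null acceptance differ by `≤ εs n → 0` in both directions. Proof: planting identity + Cauchy–Schwarz
(`Literature.Computability.Complexity.sq_sum_adv_le` at `q = 1/2` with the family `Q_B = E(B)`, `B ∈ kSubsets n (b n)`):
`adv² ≤ E_{B,B'}[2^{C(|B ∩ B'|,2)}] - 1`, and the overlap of two uniform `b`-sets has
`Pr[|B ∩ B'| ≥ j] ≤ C(b,j) (b/n)^j` (fibre factor), so the right side is `≤ Σ_{j ≥ 2} (b²/n)^j 2^{C(j,2)}/j! → 0`
because `2^{(j-1)/2} ≤ 2^{b/2} ≤ n^{1-ε/2}`. [cite: Kucera1995, §1] [folklore] -/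
theorem stub_smallCliqueInvisible :
    ∀ ε : ℝ, 0 < ε → ∀ b : ℕ → ℕ, (∀ᶠ n : ℕ in atTop, (b n : ℝ) ≤ (2 - ε) * Real.logb 2 (n : ℝ)) →
      ∀ f : (n : ℕ) → EdgeVec n → Bool,
      ∃ εs : ℕ → ℝ≥0∞, Tendsto εs atTop (𝓝 0) ∧
        ∀ᶠ n : ℕ in atTop,
          (plantedCliqueDist n (b n)).toOuterMeasure {y | f n y = true} ≤
              (erdosRenyiHalf n).toOuterMeasure {x | f n x = true} + εs n ∧
            (erdosRenyiHalf n).toOuterMeasure {x | f n x = true} ≤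
              (plantedCliqueDist n (b n)).toOuterMeasure {y | f n y = true} + εs n :=
  Summit.PneNP.PneNP.Theorems.MonotoneBlind.VertexCover.stub_smallCliqueInvisible

/-- **stub_orDisjointFamily** (M; toy accumulation for a finite family with pairwise DISJOINT supports). For tests
`g i` determined by pairwise disjoint slot sets `S i` and any planted set `A`: the dead–revival mass of `⋁ i, g i`
at `A` is `≤ Σ_i adv_A(g i) · Pr_x[all g j, j ≠ i, dead]` (the `∨` is revived through some child while the others
are dead; independence across disjoint coordinate sets, `Literature.Probability.Moments.card_filter_and_mul_eq`).
[folklore] -/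
theorem stub_orDisjointFamily :
    ∀ (n m : ℕ) (A : Finset (Fin n)) (S : Fin m → Finset ((⊤ : SimpleGraph (Fin n)).edgeSet))
      (g : Fin m → EdgeVec n → Bool),
      (∀ i j, i ≠ j → Disjoint (S i) (S j)) →
      (∀ i, ∀ x x' : EdgeVec n, (∀ e ∈ S i, x e = x' e) → g i x = g i x') →
      (erdosRenyiHalf n).toOuterMeasure
          {x | (∀ i, g i x = false) ∧ ∃ i, g i (plant A x) = true} ≤
        ∑ i, (erdosRenyiHalf n).toOuterMeasure {x | g i x = false ∧ g i (plant A x) = true} *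
          (erdosRenyiHalf n).toOuterMeasure {x | ∀ j, j ≠ i → g j x = false} :=
  Summit.PneNP.PneNP.Theorems.MonotoneBlind.VertexCover.stub_orDisjointFamily

/-- **stub_weakBlindOrCnf** (LANDED by seat 0, p170599, as a corollary of its constant-depth switching theorem
`karlinRubin_constDepth_planted_le_null_add`; this line's independent per-`n` bound is p170886. Weak blindness of ORs of polynomially many polynomial-clause monotone CNFs —
depth 3 with `∨` on top, NO quietness; seat 0's `depth3_planted_le` is the ratio form `2^t · null + C₀/n²` for the
quiet case). For `δ ∈ (0,1/2)`, `c`, `m n ≤ n^c` clause families with `≤ n^c` clauses each (eventually):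
`Pr_planted[∃ i, every clause of 𝓒 n i has a slot on] ≤ Pr_null[same] + ε n` eventually, `ε n → 0`. Route
(`Lines/Sketch.md` §A3): at a dead noise each CNF has a nonempty family of DEAD clauses; revival needs, for some `i`,
the inside of `A` to HIT every dead clause of CNF `i`; cover by the DISTINCT vertex sets of minimal hitting sets
across `i` (distinctness absorbs common clauses); the `|U| = 2` level is the pivotal-edge count (`stub_fairShare`,
free); levels `3 ≤ |U| ≤ 2c+2` need a first/higher-moment count of small minimal hitting sets at dead points in the
style of `StubWeakBlindDnfCount` / `StubBlindAndDnfPeel`; `|U| > 2c+2` is free. A counterexample is as valuable.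
[folklore] -/
theorem stub_weakBlindOrCnf :
    ∀ δ : ℝ, 0 < δ → δ < 1 / 2 → ∀ c : ℕ, ∀ m : ℕ → ℕ,
      ∀ 𝓒 : (n : ℕ) → Fin (m n) → Finset (Finset ((⊤ : SimpleGraph (Fin n)).edgeSet)),
      (∀ᶠ n : ℕ in atTop, m n ≤ n ^ c) →
      (∀ᶠ n : ℕ in atTop, ∀ i, #(𝓒 n i) ≤ n ^ c) →
      ∃ ε : ℕ → ℝ≥0∞, Tendsto ε atTop (𝓝 0) ∧
        ∀ᶠ n : ℕ in atTop,
          (plantedCliqueDist n ⌈(n : ℝ) ^ (1 / 2 - δ)⌉₊).toOuterMeasure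
              {x | ∃ i, ∀ S ∈ 𝓒 n i, ∃ e ∈ S, x e = true} ≤
            (erdosRenyiHalf n).toOuterMeasure {x | ∃ i, ∀ S ∈ 𝓒 n i, ∃ e ∈ S, x e = true} + ε n :=
  Summit.PneNP.PneNP.Theorems.stub_weakBlindOrCnf

/-! ### Bridging the stubs to the interface (definitional unfolding) -/

/-- `ResamplingSpec` from its stub. -/
theorem resamplingSpec_of_stub : ResamplingSpec := stub_resampling

/-- `NoDeepHingeSpec` from its stub. -/
theorem noDeepHingeSpec_of_stub : NoDeepHingeSpec := stub_noDeepHinge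

/-! ### The proved composition -/

/-- **Strong blindness from the two specs** (kernel-checked, no `sorry`): with `η > 0` from
`NoDeepHingeSpec`, `Pr_planted[C n = 1] ≤ HingeMass_η(C n) + η⁻¹ · Pr_null[C n = 1] → 0 + η⁻¹ · 0`. -/
theorem strongBlind_of_specs (hR : ResamplingSpec) (hH : NoDeepHingeSpec) :
    ∀ δ : ℝ, 0 < δ → δ < 1 / 2 → ∀ c : ℕ, ∀ C : (n : ℕ) → Circuit ((⊤ : SimpleGraph (Fin n)).edgeSet),
      (∀ᶠ n : ℕ in atTop, (C n).IsOver monotoneBasis01 ∧ (C n).size ≤ n ^ c) →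
      Tendsto (fun n : ℕ => (erdosRenyiHalf n).toOuterMeasure {x | (C n).eval x = true}) atTop (𝓝 0) →
      Tendsto (fun n : ℕ => (plantedCliqueDist n ⌈(n : ℝ) ^ (1 / 2 - δ)⌉₊).toOuterMeasure
        {x | (C n).eval x = true}) atTop (𝓝 0) := by
  intro δ hδ hδ' c C hC hnull
  obtain ⟨η, hη, hT⟩ := hH δ hδ hδ' c C hC hnull
  have hη' : η⁻¹ ≠ ⊤ := ENNReal.inv_ne_top.2 hη.ne'
  have hbound : Tendsto (fun n : ℕ => hingeMass n ⌈(n : ℝ) ^ (1 / 2 - δ)⌉₊ (C n).eval η +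
      η⁻¹ * (erdosRenyiHalf n).toOuterMeasure {x | (C n).eval x = true}) atTop (𝓝 0) := by
    have h2 := ENNReal.Tendsto.const_mul hnull (Or.inr hη' : (0 : ℝ≥0∞) ≠ 0 ∨ η⁻¹ ≠ ⊤)
    simpa using hT.add h2
  exact tendsto_of_tendsto_of_tendsto_of_le_of_le' tendsto_const_nhds hbound
    (Eventually.of_forall fun _ => bot_le) (Eventually.of_forall fun n => hR n _ (C n).eval η)

/-- **THE SKELETON THEOREM `MonotoneBlind_of`.** The crux `Summit.PneNP.PneNP.Theses.KarlinRubin.MonotoneBlind`,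
concluded BY NAME from the registered stubs: strong blindness from `stub_resampling` + `stub_noDeepHinge`
(`strongBlind_of_specs`), then the landed `monotoneBlind_of_strongBlind` (p160653). -/
theorem MonotoneBlind_of : Summit.PneNP.PneNP.Theses.KarlinRubin.MonotoneBlind :=
  Summit.PneNP.PneNP.Theorems.MonotoneBlind.VertexCover.monotoneBlind_of_strongBlind
    (strongBlind_of_specs resamplingSpec_of_stub noDeepHingeSpec_of_stub)

end Summit.PneNP.PneNP.Cruxes.MonotoneBlind.VertexCover
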